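import Summits.QuantumFields.BalabanUV.Beta.GAN24.E3UnitSplitLevels
import Literature.MathematicalPhysics.QuantumFieldTheory.Balaban1983to89.Beta.KernelWard

/-!
# `BalabanUV.Beta.GAN24.E3UnitSplitSum` — binder row G-an2-4 / (CONV-C), S-slot, road «S3-fibre²»: THE (PC-1) UNIT SPLIT OF THE NORMALISED
# THIRD JET, part 3 — ADDITIVITY of the third-jet functional over finite families of local stencil families and THE MEMBER DECOMPOSITION
# `e3Of … (n+2) = Σ` of the `2n+5` weighted pieces of `Sc_succ_channels`, each in the shape the templates of part 2 consume (the D-S3-1∕D-S3-2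
# term list as ONE kernel equation; engine of the idle leaf seat b2b-balaban-gan24-formalise-leaf-01-g10)

NOT IN PRINT; OUR PROOF ATTEMPT.  HONEST FRAMING (cell contract, verbatim): «discharging `BetaPertH` makes Bałaban's UV stability
UNCONDITIONAL — a real constructive-QFT result; it is NOT the continuum limit and NOT the Clay problem.»  HONEST DEPENDENCY (verbatim):
«continuum YM on T⁴ ⇐ BetaPertH ∧ nine spine estimates (0/9 proved); BetaPertH ⇐ (D1) ∧ (D4) ∧ CAP+tail; G-an2-4 gates asym, D1 and
NE2/3/4.»  [folklore] over an2's DEFINITIONS; the ONE place of the three modules where tsums are split — `e3OfS_finset_sum` — does so under the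
slice summabilities supplied by an2's `decays_KInv` / `vertexFamily_vertexOf'` / `decay_wH` through pv's `KernelWard.slices_bdd_biLoc` /
`slices_biLoc_bdd` BY NAME; no estimate beyond those existing decay lemmas, no cited fact, no `def`, no `Prop` mirror.  Discharges NOTHING of
«E3Shape»/«E3SupRate», (hS, hSall), the K-slot, BetaPertH; NOT continuum, NOT Clay.

## What is proved (generic `d`, `Lc ≥ 1`)
§5b the level-`0` (V-H) template `e3VH0_unit_split` (`P = pushSum Lc (Lc^k) (mfNeg (vhS d Lc κ u))`, `e3VH0_residual`; here for file size).
§6 `vertexOf_finset_sum`, `mmRead_finset_sum`, **`e3OfS_finset_sum`** / `e3OfS_add` (additivity over finite families of LOCAL stencil families);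
   `loc_add`/`loc_sum`/`loc_smul`/`loc_push` and the localisation of every piece BY NAME (`loc_wilsonA`, `loc_vh0`, `loc_lam0`, `loc_borderInc`,
   `loc_lagrInc` — an2/an1/an3's `locStencil_*`, `biLoc_pushSum`); `pushSum_wilsonA`/`pushSum_SLam0`/`pushSum_lagrInc` (push-invariance of the ff
   pieces); **`Sc_succ_channels`** — `PushSumNest.Sc_succ_closed` regrouped by channel and level with ONE merged weight per piece;
   **`e3Of_one_decomp`** (member 1 = the three channels of `S₀`) and **`e3Of_succ_succ_decomp`** (member `n+2`, every `n`):
   `e3Of … (n+1+1) = e3OfS N (W) + e3OfS N (VH₀ pushed n+1 times) + e3OfS N (Λ₀) + e3OfS N (top border) + e3OfS N (top Λ)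
     + Σ_{m<n} (e3OfS N (border_{m+1} pushed n−m times) + e3OfS N (Λ_{m+1}))` entrywise, `N = Lc^{n+1+1}`,
   each summand LITERALLY the argument of `e3W_unit_split` (at `n+1`), `e3VH0_unit_split`/`e3Lam0_unit_split` (`k = n+1`), `e3VHTop_unit_split`/
   `e3LamTop_unit_split` (`ℓ = n+1`), `e3VH_unit_split`/`e3Lam_unit_split` (`ℓ = m+1`, `k = n−m`, `hp` by `omega`) — so `N^{2(d+1)}·e3Of … (n+2)`
   is the displayed sum of `2n+5` unit sandwiches with displayed residual powers (`N^{d−3}`; `N^{−2}`, `N^{d−2}`; `N^{−2}M`, `N^{d−2}M^{d+3}` per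
   lower level), which is what D-S3-1∕D-S3-2 transcribe.
-/

noncomputable section

open Finset
open scoped BigOperators
open Literature.MathematicalPhysics.QuantumFieldTheory
open Literature.MathematicalPhysics.QuantumFieldTheory.Balaban1983to89
open Literature.MathematicalPhysics.QuantumFieldTheory.Balaban1983to89.Beta
open ExpKernelCalculus (MKer comp)
open KernelSpecInstance (wH wΦ)
open KKTFluctuationKernel (Gam GamΦ)
open OneStepResolventKernel (Fib LocStencil KInv wsum vertexOf KInv_inl_inr_coarse KInv_inr_inl_coarse KInv_inl_inl)
open StepJetData (wilsonA mfNeg)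
open AveragingHessianKernels (vhS hessFF)
open InterLevelTransport (SLam avgLift cwsum cwsum_apply)
open BalabanStepJets (S0 lamCoeffOf)
open BalabanCompositeJets (Sc pushSum pushSum_inl_inl borderInc lagrInc)
open BalabanStepJetsSucc (e3Of mmRead)
open B12Sec2to5 (l1 l1_nonneg)

namespace Summit.QuantumFields.BalabanUV.Beta.GAN24.E3UnitSplit

variable {d : ℕ} {N : ℕ} [NeZero N]

/-! ## §5b The level-`0` (V-H) template (moved here from part 2 for file size) -/

section Level0

variable {Lc : ℕ} [NeZero Lc]

omit [NeZero Lc] in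
/-- [folklore] A pushed `S₀` (V-H) stencil is off-diagonal (ff). -/
theorem pushSum_vh0_inl_inl {M L : ℕ} (κ : Fin (d + 1)) (u x z : Fin (d + 1) → ℤ) (α β : Fin (d + 1)) :
    pushSum M L (mfNeg (vhS d Lc κ u)) x z (Sum.inl α) (Sum.inl β) = 0 := by
  rw [pushSum_inl_inl, vh0_inl_inl]

omit [NeZero Lc] in
/-- [folklore] A pushed `S₀` (V-H) stencil is off-diagonal (mm). -/
theorem pushSum_vh0_inr_inr {M L : ℕ} (κ : Fin (d + 1)) (u x z : Fin (d + 1) → ℤ) (μ ν : Fin (d + 1)) :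
    pushSum M L (mfNeg (vhS d Lc κ u)) x z (Sum.inr μ) (Sum.inr ν) = 0 :=
  pushSum_block_zero _ _ _ (fun x z => vh0_inr_inr κ u x z μ ν) x z

/-- [folklore] The level-`0` exponent identity of the (V-H) channel (`M = 1`). -/
theorem e3VH0_residual (cVH : ℝ) (k : ℕ) :
    ((Lc : ℝ) ^ (k + 1)) ^ (2 * (d + 1)) * (((Lc : ℝ) ^ (d + 1)) ^ k * cVH) =
      cVH / (Lc : ℝ) ^ (d + 1) * ((Lc : ℝ) ^ (k + 1)) ^ (-(2 : ℤ)) *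
        (((Lc : ℝ) ^ (k + 1)) ^ (2 * (d + 1)) * (((Lc : ℝ) ^ (k + 1)) ^ (d + 1))⁻¹ * ((Lc : ℝ) ^ (k + 1)) ^ (d + 2) *
          ((Lc : ℝ) ^ (k + 1)) ^ (d + 2)) := by
  have hL : (Lc : ℝ) ≠ 0 := by exact_mod_cast NeZero.ne Lc
  have hN : ((Lc : ℝ) ^ (k + 1)) ≠ 0 := pow_ne_zero _ hL
  rw [zpow_neg, zpow_ofNat]
  field_simp
  ring

/-- [folklore] **THE (V-H) TEMPLATE, LEVEL `0`, PUSHED `k` TIMES** (`S₀`'s (V-H) stencil, natural weight `(Lc^{d+1})^k·cVH`, member `p = k+1`;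
`M = 1`): `P = pushSum Lc (Lc^k) (mfNeg (vhS d Lc κ u))`. -/
theorem e3VH0_unit_split (cVH : ℝ) (k p : ℕ) (hp : p = k + 1) (κ' : Fin (d + 1)) (u' x' z' : Fin (d + 1) → ℤ) (α β : Fin (d + 1)) :
    ((Lc : ℝ) ^ p) ^ (2 * (d + 1)) *
        e3OfS (Lc ^ p) (fun κ u => (((Lc : ℝ) ^ (d + 1)) ^ k * cVH) • pushSum Lc (Lc ^ k) (mfNeg (vhS d Lc κ u))) κ' u' x' z' (Sum.inl α) (Sum.inl β) =
      -(cVH / (Lc : ℝ) ^ (d + 1)) * ((Lc : ℝ) ^ p) ^ (-(2 : ℤ)) *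
        ∑' y : Fin (d + 1) → ℤ,
          ((∑ l' : Fin (d + 1),
            (∑' w : Fin (d + 1) → ℤ, ∑ l : Fin (d + 1),
                (((Lc : ℝ) ^ p) ^ (2 * (d + 1)) * KInv (N := Lc ^ p) (d := d) (((Lc ^ p : ℕ) : ℤ) • x') w (Sum.inr α) (Sum.inr l)) *
                ∑ κ'' : Fin (d + 1), (((Lc : ℝ) ^ p) ^ (d + 1))⁻¹ * ∑' u : Fin (d + 1) → ℤ,
                  (((Lc : ℝ) ^ p) ^ (d + 2) * wH (N := Lc ^ p) κ'' κ' (u - ((Lc ^ p : ℕ) : ℤ) • u')) *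
                    pushSum Lc (Lc ^ k) (mfNeg (vhS d Lc κ'' u)) w y (Sum.inr l) (Sum.inl l')) *
              (((Lc : ℝ) ^ p) ^ (d + 2) * wH (N := Lc ^ p) l' β (y - ((Lc ^ p : ℕ) : ℤ) • z'))) +
          ∑ l' : Fin (d + 1),
            (∑' w : Fin (d + 1) → ℤ, ∑ l : Fin (d + 1),
                (((Lc : ℝ) ^ p) ^ (d + 2) * GamΦ (N := Lc ^ p) α x' l w) *
                ∑ κ'' : Fin (d + 1), (((Lc : ℝ) ^ p) ^ (d + 1))⁻¹ * ∑' u : Fin (d + 1) → ℤ,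
                  (((Lc : ℝ) ^ p) ^ (d + 2) * wH (N := Lc ^ p) κ'' κ' (u - ((Lc ^ p : ℕ) : ℤ) • u')) *
                    pushSum Lc (Lc ^ k) (mfNeg (vhS d Lc κ'' u)) w y (Sum.inl l) (Sum.inr l')) *
              (((Lc : ℝ) ^ p) ^ (2 * (d + 1)) *
                KInv (N := Lc ^ p) (d := d) y (((Lc ^ p : ℕ) : ℤ) • z') (Sum.inr l') (Sum.inr β))) := by
  subst hp
  rw [e3OfS_offdiag _ (fun κ u x z α' β' => by simp only [Pi.smul_apply, smul_eq_mul, pushSum_vh0_inl_inl, mul_zero])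
    (fun κ u x z μ ν => by simp only [Pi.smul_apply, smul_eq_mul, pushSum_vh0_inr_inr, mul_zero])]
  simp only [Pi.smul_apply, smul_eq_mul]
  rw [pull_two_inner, pull_two_legs _ _ _ _ _ _ _ _ _ _ _ _ _ (by ring)]
  have h := e3VH0_residual (Lc := Lc) (d := d) cVH k
  have key : ∀ {N2 C D Z a b c g T : ℝ}, N2 * C = D * Z * (a * b * c * g) →
      N2 * -(C * T) = -D * Z * (a * b * c * g * T) := by
    intro N2 C D Z a b c g T h
    calc N2 * -(C * T) = -(N2 * C) * T := by ring
      _ = -(D * Z * (a * b * c * g)) * T := by rw [h]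
      _ = -D * Z * (a * b * c * g * T) := by ring
  exact key h

end Level0

/-! ## §6 Additivity of the third-jet functional and THE MEMBER DECOMPOSITION -/

section Sum

open ExpKernelCalculus (Decays BiLoc VertexFamily biLoc_comp_decays summable_exp_shift')
open KernelSpecInstance (decay_wH)
open KernelWard (Bdd bdd_of_decays bdd_of_biLoc slices_bdd_biLoc slices_biLoc_bdd comp_finset_sum_right comp_finset_sum_left)
open OneStepResolventKernel (decays_KInv vertexFamily_vertexOf' decays_mono biLoc_mono)
open StepJetData (locStencil_add locStencil_smul locStencil_mfNeg locStencil_wilsonA)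
open AveragingHessianKernels (locStencil_vhS biLoc_hessFF ell)
open InterLevelTransport (locStencil_SLam)
open BalabanStepJets (abs_lamCoeffOf_le locStencil_mono)
open BalabanCompositeJets (biLoc_pushSum locStencil_borderInc locStencil_lagrInc)
open Summit.QuantumFields.BalabanUV.Beta.GAN24.PushSumNest (pushSum_add pushSum_smul Sc_succ_closed)

/-- [folklore] **THE ONE-SHOT VERTEX IS ADDITIVE OVER FINITE FAMILIES OF LOCAL STENCIL FAMILIES** (each summand's weighted
superposition is absolutely summable: decaying `ℋ`-weights × bounded stencils). -/
theorem vertexOf_finset_sum {ι : Type*} (s : Finset ι) (S : ι → Fin (d + 1) → (Fin (d + 1) → ℤ) → MKer (d + 1) (Fib d))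
    (hS : ∀ i ∈ s, ∃ C δ : ℝ, 0 < δ ∧ LocStencil (S i) C δ) (μ : Fin (d + 1)) (y : Fin (d + 1) → ℤ) :
    vertexOf (N := N) (fun κ u => ∑ i ∈ s, S i κ u) μ y = ∑ i ∈ s, vertexOf (N := N) (S i) μ y := by
  obtain ⟨δw, Cw, hδw, hwH⟩ := decay_wH (N := N) (d := d)
  funext x z a b
  simp only [vertexOf, wsum, Finset.sum_apply, Finset.mul_sum]
  rw [Finset.sum_comm]
  refine Finset.sum_congr rfl fun κ' _ => ?_
  refine Summable.tsum_finsetSum fun i hi => ?_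
  obtain ⟨C, δ, hδ, hloc⟩ := hS i hi
  have hB : ∀ u, |S i κ' u x z a b| ≤ C := fun u => bdd_of_biLoc (hloc κ' u) hδ.le x z a b
  refine Summable.of_norm_bounded ((summable_exp_shift' hδw ((N : ℤ) • y)).mul_left (Cw * C)) (fun u => ?_)
  rw [Real.norm_eq_abs, abs_mul]
  have h1 : |wH (N := N) κ' μ (u - (N : ℤ) • y)| ≤ Cw * Real.exp (-δw * l1 (u - (N : ℤ) • y)) := hwH κ' μ _
  have hCw : 0 ≤ Cw := le_trans (abs_nonneg _) ((hwH κ' μ 0).trans_eq (by simp [B12Sec2to5.l1]))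
  calc |wH (N := N) κ' μ (u - (N : ℤ) • y)| * |S i κ' u x z a b|
      ≤ (Cw * Real.exp (-δw * l1 (u - (N : ℤ) • y))) * C := mul_le_mul h1 (hB u) (abs_nonneg _) (by positivity)
    _ = Cw * C * Real.exp (-δw * l1 (u - (N : ℤ) • y)) := by ring

/-- [folklore] The `mm`-read is additive over finite sums (pointwise). -/
theorem mmRead_finset_sum {ι : Type*} (s : Finset ι) (M : ℕ) (F : ι → MKer (d + 1) (Fib d)) (x' z' : Fin (d + 1) → ℤ)
    (a b : Fib d) : mmRead M (∑ i ∈ s, F i) x' z' a b = ∑ i ∈ s, mmRead M (F i) x' z' a b := by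
  rcases a with α | μ <;> rcases b with β | ν <;>
    simp only [BalabanStepJetsSucc.mmRead_inl_inl, BalabanStepJetsSucc.mmRead_inr_left, BalabanStepJetsSucc.mmRead_inr_right,
      Finset.sum_apply, Finset.sum_const_zero]

/-- [folklore] **THE THIRD-JET FUNCTIONAL IS ADDITIVE OVER FINITE FAMILIES OF LOCAL STENCIL FAMILIES** — the ONE place in this module
where tsums are split, under the slice summabilities supplied by an2's `decays_KInv` and `vertexFamily_vertexOf'` through pv's
`KernelWard.slices_bdd_biLoc` / `slices_biLoc_bdd`. -/
theorem e3OfS_finset_sum {ι : Type*} (s : Finset ι) (S : ι → Fin (d + 1) → (Fin (d + 1) → ℤ) → MKer (d + 1) (Fib d))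
    (hS : ∀ i ∈ s, ∃ C δ : ℝ, 0 < δ ∧ LocStencil (S i) C δ) (κ' : Fin (d + 1)) (u' x' z' : Fin (d + 1) → ℤ) (a b : Fib d) :
    e3OfS N (fun κ u => ∑ i ∈ s, S i κ u) κ' u' x' z' a b = ∑ i ∈ s, e3OfS N (S i) κ' u' x' z' a b := by
  obtain ⟨δK, CK, hδK, hCK, hK⟩ := decays_KInv (N := N) (d := d)
  have hKb : Bdd (KInv (N := N) (d := d)) CK := bdd_of_decays hK hδK.le
  have hV : ∀ i ∈ s, ∃ Cv δv : ℝ, 0 < δv ∧ BiLoc (vertexOf (N := N) (S i) κ' u') ((N : ℤ) • u') ((N : ℤ) • u') Cv δv := by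
    intro i hi
    obtain ⟨C, δ, hδ, hloc⟩ := hS i hi
    obtain ⟨Cv, δv, hδv, hVF⟩ := vertexFamily_vertexOf' (N := N) hloc hδ
    exact ⟨Cv, δv, hδv, hVF κ' u'⟩
  simp only [e3OfS]
  rw [show vertexOf (N := N) (fun κ u => ∑ i ∈ s, S i κ u) κ' u' = ∑ i ∈ s, vertexOf (N := N) (S i) κ' u' by
    rw [vertexOf_finset_sum s S hS]]
  rw [comp_finset_sum_right s (fun i hi x z a b => by
    obtain ⟨Cv, δv, hδv, hVi⟩ := hV i hi
    exact slices_bdd_biLoc hKb hVi hδv x z a b)]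
  rw [comp_finset_sum_left s (fun i hi x z a b => by
    obtain ⟨Cv, δv, hδv, hVi⟩ := hV i hi
    have hm : 0 < min δK δv := lt_min hδK hδv
    have hKm : Decays (KInv (N := N) (d := d)) CK (min δK δv) := decays_mono hK hCK le_rfl (min_le_left _ _)
    have hVm : BiLoc (vertexOf (N := N) (S i) κ' u') ((N : ℤ) • u') ((N : ℤ) • u') Cv (min δK δv) :=
      biLoc_mono hVi (hVi.nonneg (Sum.inl 0)) (min_le_right _ _)
    have hA := biLoc_comp_decays hKm hVm (show (0 : ℝ) ≤ min δK δv / 2 by positivity) (by linarith)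
    exact slices_biLoc_bdd hA hKb (half_pos hm) x z a b)]
  rw [mmRead_finset_sum, ← Finset.sum_neg_distrib]

/-- [folklore] Binary additivity (from the finite-family version on `Bool`). -/
theorem e3OfS_add {S₁ S₂ : Fin (d + 1) → (Fin (d + 1) → ℤ) → MKer (d + 1) (Fib d)}
    (h₁ : ∃ C δ : ℝ, 0 < δ ∧ LocStencil S₁ C δ) (h₂ : ∃ C δ : ℝ, 0 < δ ∧ LocStencil S₂ C δ)
    (κ' : Fin (d + 1)) (u' x' z' : Fin (d + 1) → ℤ) (a b : Fib d) :
    e3OfS N (fun κ u => S₁ κ u + S₂ κ u) κ' u' x' z' a b = e3OfS N S₁ κ' u' x' z' a b + e3OfS N S₂ κ' u' x' z' a b := by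
  have h := e3OfS_finset_sum (N := N) (Finset.univ : Finset Bool) (fun t => cond t S₁ S₂)
    (fun t _ => by cases t <;> assumption) κ' u' x' z' a b
  simpa only [Fintype.sum_bool, cond_true, cond_false] using h

/-! ### Localisation of the pieces (existential form; every rate from an2/an1 BY NAME) -/

/-- [folklore] sums of local families are local (common rate = the minimum). -/
theorem loc_add {S₁ S₂ : Fin (d + 1) → (Fin (d + 1) → ℤ) → MKer (d + 1) (Fib d)}
    (h₁ : ∃ C δ : ℝ, 0 < δ ∧ LocStencil S₁ C δ) (h₂ : ∃ C δ : ℝ, 0 < δ ∧ LocStencil S₂ C δ) :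
    ∃ C δ : ℝ, 0 < δ ∧ LocStencil (fun κ u => S₁ κ u + S₂ κ u) C δ := by
  obtain ⟨C₁, δ₁, hδ₁, hS₁⟩ := h₁
  obtain ⟨C₂, δ₂, hδ₂, hS₂⟩ := h₂
  refine ⟨C₁ + C₂, min δ₁ δ₂, lt_min hδ₁ hδ₂, locStencil_add ?_ ?_⟩
  · exact locStencil_mono hS₁ ((hS₁ 0 0).nonneg (Sum.inl 0)) (min_le_left _ _)
  · exact locStencil_mono hS₂ ((hS₂ 0 0).nonneg (Sum.inl 0)) (min_le_right _ _)

/-- [folklore] finite sums of local families are local. -/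
theorem loc_sum {ι : Type*} (s : Finset ι) (S : ι → Fin (d + 1) → (Fin (d + 1) → ℤ) → MKer (d + 1) (Fib d))
    (hS : ∀ i ∈ s, ∃ C δ : ℝ, 0 < δ ∧ LocStencil (S i) C δ) :
    ∃ C δ : ℝ, 0 < δ ∧ LocStencil (fun κ u => ∑ i ∈ s, S i κ u) C δ := by
  classical
  induction s using Finset.induction_on with
  | empty =>
      refine ⟨0, 1, one_pos, fun κ u x z a b => ?_⟩
      simp only [Finset.sum_empty, Pi.zero_apply, abs_zero, zero_mul, le_refl]
  | insert i s hi ih =>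
      have h := loc_add (hS i (Finset.mem_insert_self i s)) (ih fun j hj => hS j (Finset.mem_insert_of_mem hj))
      simpa only [Finset.sum_insert hi] using h

/-- [folklore] scalar multiples of local families are local. -/
theorem loc_smul (c : ℝ) {S : Fin (d + 1) → (Fin (d + 1) → ℤ) → MKer (d + 1) (Fib d)}
    (h : ∃ C δ : ℝ, 0 < δ ∧ LocStencil S C δ) : ∃ C δ : ℝ, 0 < δ ∧ LocStencil (fun κ u => c • S κ u) C δ := by
  obtain ⟨C, δ, hδ, hS⟩ := h
  exact ⟨_, δ, hδ, locStencil_smul c hS⟩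

/-- [folklore] pushes of local families are local (an2's `biLoc_pushSum`). -/
theorem loc_push {M L : ℕ} [NeZero M] [NeZero L] (hL : 1 ≤ L) {S : Fin (d + 1) → (Fin (d + 1) → ℤ) → MKer (d + 1) (Fib d)}
    (h : ∃ C δ : ℝ, 0 < δ ∧ LocStencil S C δ) :
    ∃ C δ : ℝ, 0 < δ ∧ LocStencil (fun κ u => pushSum M L (S κ u)) C δ := by
  obtain ⟨C, δ, hδ, hS⟩ := h
  exact ⟨_, δ, hδ, fun κ u => biLoc_pushSum hL (hS κ u) hδ.le⟩

variable {Lc : ℕ} [NeZero Lc]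

/-- [folklore] the Wilson table is local (an3/an2 `locStencil_wilsonA`, rate 1). -/
theorem loc_wilsonA : ∃ C δ : ℝ, 0 < δ ∧ LocStencil (wilsonA d) C δ := ⟨_, 1, one_pos, locStencil_wilsonA zero_le_one⟩

omit [NeZero Lc] in
/-- [folklore] S₀'s (V-H) stencil is local (an1 `locStencil_vhS`). -/
theorem loc_vh0 (hLc : 1 ≤ Lc) : ∃ C δ : ℝ, 0 < δ ∧ LocStencil (fun κ u => mfNeg (vhS d Lc κ u)) C δ :=
  ⟨_, 1, one_pos, locStencil_mfNeg (locStencil_vhS hLc zero_le_one)⟩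

/-- [folklore] S₀'s Lagrange stencil is local (the Λ third of an2's `locStencil_S0`). -/
theorem loc_lam0 (hLc : 1 ≤ Lc) :
    ∃ C δ : ℝ, 0 < δ ∧ LocStencil (SLam Lc (lamCoeffOf (KInv (N := Lc) (d := d)) Lc) (fun μ y => hessFF Lc μ y)) C δ := by
  obtain ⟨δ₀, C, hδ₀, hC, hdec⟩ := decays_KInv (N := Lc) (d := d)
  have hc := abs_lamCoeffOf_le (N := Lc) hdec hC hδ₀.le
  have hQ : VertexFamily (fun μ y => hessFF (d := d) Lc μ y) Lc
      (2 * (ell (d + 1) Lc : ℝ) ^ 2 * Real.exp (4 * ((d : ℝ) + 1) * Lc * δ₀)) δ₀ := fun μ y => biLoc_hessFF hLc μ y hδ₀.le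
  exact ⟨_, δ₀ / 2, half_pos hδ₀, locStencil_SLam (N := Lc) hc hQ hδ₀ (mul_nonneg (mul_nonneg (by positivity) hC) (Real.exp_pos _).le)⟩

omit [NeZero Lc] in
/-- [folklore] border increments are local (an2 `locStencil_borderInc`). -/
theorem loc_borderInc (hLc : 1 ≤ Lc) (M : ℕ) [NeZero M] : ∃ C δ : ℝ, 0 < δ ∧ LocStencil (borderInc d Lc M) C δ :=
  ⟨_, 1, one_pos, locStencil_borderInc hLc zero_le_one⟩

/-- [folklore] Lagrange increments are local (an2 `locStencil_lagrInc`). -/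
theorem loc_lagrInc (hLc : 1 ≤ Lc) (m : ℕ) : ∃ C δ : ℝ, 0 < δ ∧ LocStencil (lagrInc d Lc (Lc ^ (m + 1)) (Lc ^ (m + 1 + 1))) C δ :=
  locStencil_lagrInc hLc (pow_succ Lc (m + 1))

/-! ### The member decompositions -/

/-- [folklore] **MEMBER 1** (`N = Lc`, reads `Sc 0 = S₀`, no push): `e3Of … 1 = e3OfS Lc (cE•wilsonA) + e3OfS Lc (cVH•mfNeg∘vhS) + e3OfS Lc (cΛ•S^Λ₀)`
entrywise — the three channels of the first member. -/
theorem e3Of_one_decomp (hLc : 1 ≤ Lc) (cE cVH cΛ : ℝ) (κ' : Fin (d + 1)) (u' x' z' : Fin (d + 1) → ℤ) (a b : Fib d) :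
    e3Of d Lc cE cVH cΛ 1 κ' u' x' z' a b =
      e3OfS (Lc ^ 1) (fun κ u => cE • wilsonA d κ u) κ' u' x' z' a b +
        e3OfS (Lc ^ 1) (fun κ u => cVH • mfNeg (vhS d Lc κ u)) κ' u' x' z' a b +
        e3OfS (Lc ^ 1) (fun κ u => cΛ • SLam Lc (lamCoeffOf (KInv (N := Lc) (d := d)) Lc) (fun μ y => hessFF Lc μ y) κ u)
          κ' u' x' z' a b := by
  rw [e3Of_succ_eq_e3OfS]
  rw [show Sc d Lc cE cVH cΛ 0 = fun κ u => (cE • wilsonA d κ u + cVH • mfNeg (vhS d Lc κ u)) +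
      cΛ • SLam Lc (lamCoeffOf (KInv (N := Lc) (d := d)) Lc) (fun μ y => hessFF Lc μ y) κ u from rfl]
  rw [e3OfS_add (loc_add (loc_smul cE loc_wilsonA) (loc_smul cVH (loc_vh0 hLc))) (loc_smul cΛ (loc_lam0 hLc)),
    e3OfS_add (loc_smul cE loc_wilsonA) (loc_smul cVH (loc_vh0 hLc))]


section Member

variable {Lc : ℕ} [NeZero Lc]

/-- [folklore] the Wilson table is push-invariant (ff-supported). -/
theorem pushSum_wilsonA {M L : ℕ} (κ : Fin (d + 1)) (u : Fin (d + 1) → ℤ) : pushSum M L (wilsonA d κ u) = wilsonA d κ u :=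
  pushSum_of_ff _ (fun x z α ν => wilsonA_inl_inr κ u x z α ν) (fun x z μ α => wilsonA_inr κ u x z μ (Sum.inl α))
    (fun x z μ ν => wilsonA_inr κ u x z μ (Sum.inr ν))

/-- [folklore] `S₀`'s Lagrange stencil is push-invariant (ff-supported). -/
theorem pushSum_SLam0 {M L : ℕ} (κ : Fin (d + 1)) (u : Fin (d + 1) → ℤ) :
    pushSum M L (SLam Lc (lamCoeffOf (KInv (N := Lc) (d := d)) Lc) (fun μ y => hessFF Lc μ y) κ u) =
      SLam Lc (lamCoeffOf (KInv (N := Lc) (d := d)) Lc) (fun μ y => hessFF Lc μ y) κ u :=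
  pushSum_of_ff _ (fun x z α ν => SLam0_inl_inr κ u x z α ν) (fun x z μ α => SLam0_inr κ u x z μ (Sum.inl α))
    (fun x z μ ν => SLam0_inr κ u x z μ (Sum.inr ν))

omit [NeZero Lc] in
/-- [folklore] Lagrange increments are push-invariant (ff-supported). -/
theorem pushSum_lagrInc {M L M' N' : ℕ} [NeZero N'] (κ : Fin (d + 1)) (u : Fin (d + 1) → ℤ) :
    pushSum M L (lagrInc d Lc M' N' κ u) = lagrInc d Lc M' N' κ u :=
  pushSum_of_ff _ (fun x z α ν => lagrInc_inl_inr κ u x z α ν) (fun x z μ α => lagrInc_inr κ u x z μ (Sum.inl α))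
    (fun x z μ ν => lagrInc_inr κ u x z μ (Sum.inr ν))

/-- [folklore] **THE CLOSED FORM OF `Sc (n+1)` REGROUPED BY CHANNEL AND LEVEL** (from `PushSumNest.Sc_succ_closed`: `S₀` unfolded, the
push distributed (`pushSum_add`/`pushSum_smul`) and removed from the ff pieces (`pushSum_of_ff`), every scalar merged into ONE weight per
piece in the shape the templates of §5 consume). -/
theorem Sc_succ_channels (cE cVH cΛ : ℝ) (n : ℕ) :
    Sc d Lc cE cVH cΛ (n + 1) = fun κ u =>
      (cE * ((Lc : ℝ) ^ (d + 1)) ^ (n + 1)) • wilsonA d κ u +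
      (((Lc : ℝ) ^ (d + 1)) ^ (n + 1) * cVH) • pushSum Lc (Lc ^ (n + 1)) (mfNeg (vhS d Lc κ u)) +
      (((Lc : ℝ) ^ (d + 1)) ^ (n + 1) * cΛ) • SLam Lc (lamCoeffOf (KInv (N := Lc) (d := d)) Lc) (fun μ y => hessFF Lc μ y) κ u +
      (cVH * ((Lc : ℝ) ^ (n + 1)) ^ (d + 2)) • borderInc d Lc (Lc ^ (n + 1)) κ u +
      (cΛ * ((Lc : ℝ) ^ (n + 1)) ^ (2 * d + 4)) • lagrInc d Lc (Lc ^ (n + 1)) (Lc ^ (n + 1 + 1)) κ u +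
      ∑ m ∈ Finset.range n,
        ((((Lc : ℝ) ^ (d + 1)) ^ (n - m) * (cVH * ((Lc : ℝ) ^ (m + 1)) ^ (d + 2))) •
            pushSum (Lc ^ (m + 1 + 1)) (Lc ^ (n - m)) (borderInc d Lc (Lc ^ (m + 1)) κ u) +
          (((Lc : ℝ) ^ (d + 1)) ^ (n - m) * (cΛ * ((Lc : ℝ) ^ (m + 1)) ^ (2 * d + 4))) •
            lagrInc d Lc (Lc ^ (m + 1)) (Lc ^ (m + 1 + 1)) κ u) := by
  funext κ u
  rw [Sc_succ_closed]
  simp only [S0, pushSum_add, pushSum_smul, pushSum_wilsonA, pushSum_SLam0, pushSum_lagrInc, smul_add, smul_smul,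
    Finset.sum_add_distrib]
  show _ = _ + _ + _ + _ + (cΛ * ((Lc : ℝ) ^ (n + 1)) ^ (2 * d + 4)) • lagrInc d Lc (Lc ^ (n + 1)) (Lc ^ (n + 2)) κ u +
    (∑ m ∈ Finset.range n, (((Lc : ℝ) ^ (d + 1)) ^ (n - m) * (cVH * ((Lc : ℝ) ^ (m + 1)) ^ (d + 2))) •
        pushSum (Lc ^ (m + 2)) (Lc ^ (n - m)) (borderInc d Lc (Lc ^ (m + 1)) κ u) +
      ∑ m ∈ Finset.range n, (((Lc : ℝ) ^ (d + 1)) ^ (n - m) * (cΛ * ((Lc : ℝ) ^ (m + 1)) ^ (2 * d + 4))) •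
        lagrInc d Lc (Lc ^ (m + 1)) (Lc ^ (m + 2)) κ u)
  rw [mul_comm (((Lc : ℝ) ^ (d + 1)) ^ (n + 1)) cE]
  abel

/-- [folklore] **THE MEMBER DECOMPOSITION** (member `n+2`, `N = Lc^{n+2}`, every `n`; entrywise, as ONE kernel equation): an2's third jet is
the SUM of the third-jet functionals of the `2n+5` weighted pieces of `Sc_succ_channels` — Wilson, level-0 (V-H) (pushed `n+1` times),
level-0 Λ, top border, top Λ, and for each lower level `m+1` (`m < n`) the pushed border increment and the Λ increment — each in EXACTLY the
shape consumed by `e3W_unit_split` (at `n+1`), `e3VH0_unit_split`/`e3Lam0_unit_split` (`k = n+1`), `e3VHTop_unit_split`/`e3LamTop_unit_split`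
(`ℓ = n+1`) and `e3VH_unit_split`/`e3Lam_unit_split` (`ℓ = m+1`, `k = n−m`, `p = n+1+1` by `omega`).  This is the D-S3-1∕D-S3-2 term list
as a theorem: `M^{2(d+1)}·e3Of` is the sum of `2n+5` displayed unit sandwiches with displayed residual powers.  (tsum additivity under
the slice summabilities of `e3OfS_finset_sum`; nothing estimated.) -/
theorem e3Of_succ_succ_decomp (hLc : 1 ≤ Lc) (cE cVH cΛ : ℝ) (n : ℕ) (κ' : Fin (d + 1)) (u' x' z' : Fin (d + 1) → ℤ) (a b : Fib d) :
    e3Of d Lc cE cVH cΛ (n + 1 + 1) κ' u' x' z' a b =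
      e3OfS (Lc ^ (n + 1 + 1)) (fun κ u => (cE * ((Lc : ℝ) ^ (d + 1)) ^ (n + 1)) • wilsonA d κ u) κ' u' x' z' a b +
      e3OfS (Lc ^ (n + 1 + 1)) (fun κ u => (((Lc : ℝ) ^ (d + 1)) ^ (n + 1) * cVH) • pushSum Lc (Lc ^ (n + 1)) (mfNeg (vhS d Lc κ u)))
        κ' u' x' z' a b +
      e3OfS (Lc ^ (n + 1 + 1)) (fun κ u => (((Lc : ℝ) ^ (d + 1)) ^ (n + 1) * cΛ) •
        SLam Lc (lamCoeffOf (KInv (N := Lc) (d := d)) Lc) (fun μ y => hessFF Lc μ y) κ u) κ' u' x' z' a b +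
      e3OfS (Lc ^ (n + 1 + 1)) (fun κ u => (cVH * ((Lc : ℝ) ^ (n + 1)) ^ (d + 2)) • borderInc d Lc (Lc ^ (n + 1)) κ u) κ' u' x' z' a b +
      e3OfS (Lc ^ (n + 1 + 1)) (fun κ u => (cΛ * ((Lc : ℝ) ^ (n + 1)) ^ (2 * d + 4)) • lagrInc d Lc (Lc ^ (n + 1)) (Lc ^ (n + 1 + 1)) κ u)
        κ' u' x' z' a b +
      ∑ m ∈ Finset.range n,
        (e3OfS (Lc ^ (n + 1 + 1)) (fun κ u => (((Lc : ℝ) ^ (d + 1)) ^ (n - m) * (cVH * ((Lc : ℝ) ^ (m + 1)) ^ (d + 2))) •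
            pushSum (Lc ^ (m + 1 + 1)) (Lc ^ (n - m)) (borderInc d Lc (Lc ^ (m + 1)) κ u)) κ' u' x' z' a b +
          e3OfS (Lc ^ (n + 1 + 1)) (fun κ u => (((Lc : ℝ) ^ (d + 1)) ^ (n - m) * (cΛ * ((Lc : ℝ) ^ (m + 1)) ^ (2 * d + 4))) •
            lagrInc d Lc (Lc ^ (m + 1)) (Lc ^ (m + 1 + 1)) κ u) κ' u' x' z' a b) := by
  have hW := loc_smul (cE * ((Lc : ℝ) ^ (d + 1)) ^ (n + 1)) (loc_wilsonA (d := d))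
  have hV0 := loc_smul (((Lc : ℝ) ^ (d + 1)) ^ (n + 1) * cVH) (loc_push (M := Lc) (BalabanStepJetsSucc.one_le_pow_Lc (Lc := Lc) (n + 1)) (loc_vh0 (d := d) hLc))
  have hL0 := loc_smul (((Lc : ℝ) ^ (d + 1)) ^ (n + 1) * cΛ) (loc_lam0 (d := d) hLc)
  have hBt := loc_smul (cVH * ((Lc : ℝ) ^ (n + 1)) ^ (d + 2)) (loc_borderInc (d := d) hLc (Lc ^ (n + 1)))
  have hLt := loc_smul (cΛ * ((Lc : ℝ) ^ (n + 1)) ^ (2 * d + 4)) (loc_lagrInc (d := d) hLc n)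
  have hBm : ∀ m : ℕ, ∃ C δ : ℝ, 0 < δ ∧ LocStencil (fun κ u => (((Lc : ℝ) ^ (d + 1)) ^ (n - m) * (cVH * ((Lc : ℝ) ^ (m + 1)) ^ (d + 2))) •
      pushSum (Lc ^ (m + 1 + 1)) (Lc ^ (n - m)) (borderInc d Lc (Lc ^ (m + 1)) κ u)) C δ := fun m =>
    loc_smul _ (loc_push (M := Lc ^ (m + 1 + 1)) (BalabanStepJetsSucc.one_le_pow_Lc (Lc := Lc) (n - m)) (loc_borderInc (d := d) hLc (Lc ^ (m + 1))))
  have hLm : ∀ m : ℕ, ∃ C δ : ℝ, 0 < δ ∧ LocStencil (fun κ u => (((Lc : ℝ) ^ (d + 1)) ^ (n - m) * (cΛ * ((Lc : ℝ) ^ (m + 1)) ^ (2 * d + 4))) •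
      lagrInc d Lc (Lc ^ (m + 1)) (Lc ^ (m + 1 + 1)) κ u) C δ := fun m => loc_smul _ (loc_lagrInc (d := d) hLc m)
  have hsum : ∀ m ∈ Finset.range n, ∃ C δ : ℝ, 0 < δ ∧ LocStencil (fun κ u =>
      (((Lc : ℝ) ^ (d + 1)) ^ (n - m) * (cVH * ((Lc : ℝ) ^ (m + 1)) ^ (d + 2))) •
          pushSum (Lc ^ (m + 1 + 1)) (Lc ^ (n - m)) (borderInc d Lc (Lc ^ (m + 1)) κ u) +
        (((Lc : ℝ) ^ (d + 1)) ^ (n - m) * (cΛ * ((Lc : ℝ) ^ (m + 1)) ^ (2 * d + 4))) •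
          lagrInc d Lc (Lc ^ (m + 1)) (Lc ^ (m + 1 + 1)) κ u) C δ := fun m _ => loc_add (hBm m) (hLm m)
  have hS := loc_sum (Finset.range n) _ hsum
  rw [e3Of_succ_eq_e3OfS, Sc_succ_channels]
  rw [e3OfS_add (loc_add (loc_add (loc_add (loc_add hW hV0) hL0) hBt) hLt) hS,
    e3OfS_add (loc_add (loc_add (loc_add hW hV0) hL0) hBt) hLt, e3OfS_add (loc_add (loc_add hW hV0) hL0) hBt,
    e3OfS_add (loc_add hW hV0) hL0, e3OfS_add hW hV0, e3OfS_finset_sum (Finset.range n) _ hsum]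
  congr 1
  exact Finset.sum_congr rfl fun m _ => e3OfS_add (hBm m) (hLm m) κ' u' x' z' a b

end Member

end Sum

end Summit.QuantumFields.BalabanUV.Beta.GAN24.E3UnitSplit
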